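import Summits.CriticalPhenomena.PercolationContinuityZ3.Theorems.PercNearOneGluingNoHeavyPcintOSMRenewal
import Summits.CriticalPhenomena.PercolationContinuityZ3.Theorems.PercNearOneGluingNoHeavyPcintBFibMarginal
import Literature.Probability.Percolation.SharpnessQuasiTransitiveMeanField
import HarnessLib

/-!
# PCINT lane, PHASE 4 (kernel second-moment oriented route), step 5: the bridge to bond percolation on `ℤ^d`

Cell `prim-pcint`, seat `prim-pcint-1` (gen 13); memo `run/shared/lean/prim/pcint/T-FIBRE-ROUTE.md` §PHASE 4.

The second-moment method for the number `N` of open ORIENTED paths of length `n` from the origin of `ℤ^d`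
[Cox–Durrett 1983, (2.1)]: the oriented edges met by such paths are parametrised injectively (`OSM.edge`), the event
"some oriented path of length `n` is open" (`OSM.orientedEvent`) is determined by them, and on the finite product space
(`EdgeExpl.real_eq_sum_wt_of_injective`)

  `E N = (dp)^n`, `E N² = p^{2n} · S d (1/p) n 0`, `P(N ≥ 1) ≥ (E N)² / E N²` (Cauchy–Schwarz),

so `P_p(orientedEvent) ≥ d^{2n} / S d (1/p) n 0` (`OSM.le_real_orientedEvent`).  An open oriented path of length `m+1` leaves
the ball `B(0, m)` (its endpoint has `ℓ¹`-norm `m+1`, `OSM.norm_le_of_mem_ball`), whence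
**`OSM.le_real_armEvent`**: `d^{2(m+1)} / S d (1/p) (m+1) 0 ≤ P_p(0 ⟷ ∂B(0, m))`.
-/

noncomputable section

namespace Summit.CriticalPhenomena.PercolationContinuityZ3.Theorems.Pcint.OSM

open Finset AdaptDom EdgeExpl Literature.Probability.Percolation Literature.Probability.LatticeModels

variable {d n : ℕ}

/-! ### Levels and the successor formula -/

/-- One more step: `pos w (i+1) = pos w i + e_{w i}` for `i < n`. -/
theorem pos_succ (w : Fin n → Fin d) {i : ℕ} (hi : i < n) : pos w (i + 1) = pos w i + e (w ⟨i, hi⟩) := by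
  funext j
  simp only [pos, e, Pi.add_apply, Pi.single_apply]
  have hsplit : ∀ t : Fin n, (if (t : ℕ) < i + 1 ∧ w t = j then (1 : ℤ) else 0) =
      (if (t : ℕ) < i ∧ w t = j then (1 : ℤ) else 0) + (if t = ⟨i, hi⟩ then (if j = w ⟨i, hi⟩ then 1 else 0) else 0) := by
    intro t
    by_cases ht : t = ⟨i, hi⟩
    · subst ht
      simp only [lt_add_iff_pos_right, Nat.lt_one_iff, true_and, lt_self_iff_false, false_and, if_false, zero_add,
        if_true]
      by_cases h : w ⟨i, hi⟩ = j
      · rw [if_pos h, if_pos h.symm]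
      · rw [if_neg h, if_neg (Ne.symm h)]
    · have hne : (t : ℕ) ≠ i := fun h => ht (Fin.ext h)
      have : ((t : ℕ) < i + 1 ∧ w t = j) ↔ ((t : ℕ) < i ∧ w t = j) := by
        constructor
        · rintro ⟨h1, h2⟩; exact ⟨by omega, h2⟩
        · rintro ⟨h1, h2⟩; exact ⟨by omega, h2⟩
      rw [if_neg ht, add_zero]; exact if_congr this rfl rfl
  simp_rw [hsplit]
  rw [Finset.sum_add_distrib]
  congr 1
  simp only [Finset.sum_ite_eq', Finset.mem_univ, if_true]

/-- **Levels**: after `i ≤ n` steps the coordinates sum to `i`. -/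
theorem level (w : Fin n → Fin d) : ∀ {i : ℕ}, i ≤ n → ∑ j, pos w i j = i
  | 0, _ => by simp [pos_zero]
  | i + 1, hi => by
    rw [pos_succ w (Nat.lt_of_succ_le hi)]
    simp only [Pi.add_apply, Finset.sum_add_distrib, e, Finset.sum_pi_single', mem_univ, if_true]
    rw [level w (Nat.le_of_succ_le hi)]
    push_cast; ring

/-- Coordinates of positions are nonnegative. -/
theorem pos_nonneg (w : Fin n → Fin d) (i : ℕ) (j : Fin d) : 0 ≤ pos w i j :=
  Finset.sum_nonneg fun _ _ => by split_ifs <;> norm_num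

/-! ### The edge parametrisation -/

/-- The sites visited before time `n` by some oriented word. -/
def sites (d n : ℕ) : Finset (Site d) :=
  (univ : Finset (Fin n × (Fin n → Fin d))).image fun q => pos q.2 q.1

/-- The index set of the oriented edges in play: a visited site and a direction. -/
abbrev EIdx (d n : ℕ) := ↥(sites d n) × Fin d

/-- The oriented edge `{x, x + e_a}`. -/
def edge (y : EIdx d n) : Sym2 (Site d) := s(y.1.1, y.1.1 + e y.2)

/-- Unit vectors are injective in the direction. -/
theorem e_injective : Function.Injective (e (d := d)) := by
  intro a a' h
  have := congr_fun h a
  simp only [e, Pi.single_eq_same, Pi.single_apply] at this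
  by_contra hne
  rw [if_neg hne] at this
  exact one_ne_zero this

/-- The parametrisation is injective. -/
theorem edge_injective : Function.Injective (edge (d := d) (n := n)) := by
  rintro ⟨x, a⟩ ⟨x', a'⟩ h
  unfold edge at h
  rcases Sym2.eq_iff.1 h with ⟨h1, h2⟩ | ⟨h1, h2⟩
  · have hx : x = x' := Subtype.ext h1
    subst hx
    have ha : a = a' := e_injective (add_left_cancel h2)
    rw [ha]
  · exfalso
    have hsum : e a + e a' = (0 : Site d) := by
      have : x.1 + e a + e a' = x.1 := by rw [h2, ← h1]
      have := congr_arg (fun z => z - x.1) this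
      simpa [add_assoc, add_sub_cancel_left] using this
    have := congr_arg (fun z : Site d => ∑ j, z j) hsum
    simp only [Pi.add_apply, Finset.sum_add_distrib, e, Finset.sum_pi_single', Finset.mem_univ, if_true,
      Pi.zero_apply, Finset.sum_const_zero] at this
    norm_num at this

/-- The parametrised edges are edges of `ℤ^d`. -/
theorem edge_mem_edgeSet (y : EIdx d n) : edge y ∈ (zdGraph d).edgeSet := by
  rw [edge, SimpleGraph.mem_edgeSet, zdGraph_adj_iff]
  exact ⟨y.2, Or.inl rfl⟩

/-- The index of the `i`-th edge of the word `w`. -/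
def idx (w : Fin n → Fin d) (i : Fin n) : EIdx d n :=
  (⟨pos w i, mem_image.2 ⟨(i, w), mem_univ _, rfl⟩⟩, w i)

/-- Its edge is the `i`-th step of the oriented path. -/
theorem edge_idx (w : Fin n → Fin d) (i : Fin n) : edge (idx w i) = s(pos w i, pos w i + e (w i)) := rfl

/-- Equal indices sit at the same time. -/
theorem eq_of_idx_eq {w w' : Fin n → Fin d} {i i' : Fin n} (h : idx w i = idx w' i') : i = i' := by
  have h1 : pos w i = pos w' i' := congr_arg (fun y : EIdx d n => y.1.1) h
  have := congr_arg (fun z : Site d => ∑ j, z j) h1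
  simp only [level w (le_of_lt i.2), level w' (le_of_lt i'.2), Nat.cast_inj] at this
  exact Fin.ext this

/-- `idx w` is injective. -/
theorem idx_injective (w : Fin n → Fin d) : Function.Injective (idx w) := fun _ _ h => eq_of_idx_eq h

/-- Equal indices at the same time: same position and same letter. -/
theorem idx_eq_iff {w w' : Fin n → Fin d} {i : Fin n} : idx w i = idx w' i ↔ pos w i = pos w' i ∧ w i = w' i := by
  constructor
  · intro h; exact ⟨congr_arg (fun y : EIdx d n => y.1.1) h, congr_arg (fun y : EIdx d n => y.2) h⟩
  · rintro ⟨h1, h2⟩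
    unfold idx
    exact Prod.ext (Subtype.ext h1) h2

/-- The edge indices of a word. -/
def edgesOf (w : Fin n → Fin d) : Finset (EIdx d n) := univ.image (idx w)

/-- A word has `n` edges. -/
theorem card_edgesOf (w : Fin n → Fin d) : (edgesOf w).card = n := by
  rw [edgesOf, Finset.card_image_of_injective _ (idx_injective w), card_univ, Fintype.card_fin]

/-- **Shared edges**: `|E(w) ∩ E(w')| = K 0 w w'`. -/
theorem card_inter (w w' : Fin n → Fin d) : (edgesOf w ∩ edgesOf w').card = K 0 w w' := by
  have hset : edgesOf w ∩ edgesOf w' = (univ.filter fun i : Fin n => (0 : Site d) + pos w i = pos w' i ∧ w i = w' i).image (idx w) := by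
    ext y
    simp only [edgesOf, mem_inter, mem_image, mem_univ, true_and, mem_filter, zero_add]
    constructor
    · rintro ⟨⟨i, hi⟩, ⟨i', hi'⟩⟩
      have hii : i = i' := eq_of_idx_eq (hi.trans hi'.symm)
      subst hii
      exact ⟨i, idx_eq_iff.1 (hi.trans hi'.symm), hi⟩
    · rintro ⟨i, hi, rfl⟩
      exact ⟨⟨i, rfl⟩, ⟨i, (idx_eq_iff.2 hi).symm⟩⟩
  rw [hset, Finset.card_image_of_injective _ (idx_injective w), K]

/-! ### The event and its place in the arm event -/

/-- **Some oriented path of length `n` from the origin is open.** -/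
def orientedEvent (d n : ℕ) : Set (BondConfig (Site d)) :=
  {ω | ∃ w : Fin n → Fin d, ∀ i : Fin n, s(pos w i, pos w i + e (w i)) ∈ ω}

/-- The event is determined by the parametrised edges. -/
theorem determinedBy_orientedEvent : DeterminedBy (orientedEvent d n) (Set.range (edge (d := d) (n := n))) := by
  rw [determinedBy_iff]
  intro ω ω' h
  have key : ∀ (w : Fin n → Fin d) (i : Fin n), s(pos w i, pos w i + e (w i)) ∈ ω ↔ s(pos w i, pos w i + e (w i)) ∈ ω' := by
    intro w i
    have hmem : s(pos w i, pos w i + e (w i)) ∈ Set.range (edge (d := d) (n := n)) := ⟨idx w i, rfl⟩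
    constructor
    · intro hω; have : s(pos w i, pos w i + e (w i)) ∈ ω ∩ Set.range edge := ⟨hω, hmem⟩; rw [h] at this; exact this.1
    · intro hω; have : s(pos w i, pos w i + e (w i)) ∈ ω' ∩ Set.range edge := ⟨hω, hmem⟩; rw [← h] at this; exact this.1
  simp only [orientedEvent, Set.mem_setOf_eq, key]

/-- **Balls are `ℓ¹`-bounded**: a site of `B(0, m)` has `Σ |x_j| ≤ m`. -/
theorem norm_le_of_mem_ball : ∀ (m : ℕ) (x : Site d), x ∈ DCTQ.ball (zdGraph d) 0 m → ∑ j, |x j| ≤ m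
  | 0, x, hx => by
    rw [DCTQ.ball_zero, mem_singleton] at hx
    subst hx; simp
  | m + 1, x, hx => by
    rw [DCTQ.ball_succ, mem_union, mem_biUnion] at hx
    rcases hx with hx | ⟨u, hu, hux⟩
    · have := norm_le_of_mem_ball m x hx; push_cast; linarith
    · have hu' := norm_le_of_mem_ball m u hu
      rw [SimpleGraph.mem_neighborFinset, zdGraph_adj_iff] at hux
      obtain ⟨i, hi⟩ := hux
      have hstep : ∑ j, |x j| ≤ ∑ j, |u j| + 1 := by
        have hxu : ∀ j, |x j| ≤ |u j| + |(Pi.single i (1 : ℤ) : Site d) j| := by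
          intro j
          rcases hi with h | h
          · rw [h, Pi.add_apply]; exact abs_add_le _ _
          · have : x j = u j - (Pi.single i (1 : ℤ) : Site d) j := by rw [h, Pi.add_apply]; ring
            rw [this]; exact abs_sub _ _
        calc ∑ j, |x j| ≤ ∑ j, (|u j| + |(Pi.single i (1 : ℤ) : Site d) j|) := Finset.sum_le_sum fun j _ => hxu j
          _ = ∑ j, |u j| + 1 := by
              rw [Finset.sum_add_distrib]
              congr 1
              have habs : ∀ j, |(Pi.single i (1 : ℤ) : Site d) j| = (Pi.single i (1 : ℤ) : Site d) j := fun j =>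
                abs_of_nonneg (by simp only [Pi.single_apply]; split_ifs <;> norm_num)
              simp_rw [habs]
              rw [Finset.sum_pi_single']
              simp
      push_cast; linarith

/-- **An open oriented path of length `m+1` realises the arm event of radius `m`.** -/
theorem armEvent_of_orientedEvent {m : ℕ} {ω : BondConfig (Site d)} (hω : ω ⊆ (zdGraph d).edgeSet)
    (h : ω ∈ orientedEvent d (m + 1)) : ω ∈ DCTQ.armEvent (zdGraph d) 0 m := by
  obtain ⟨w, hw⟩ := h
  -- the open path `0 = pos w 0 → pos w 1 → ⋯ → pos w (m+1)`
  have hpath : ∀ i, i ≤ m + 1 → PathIn (openGraph ω) Set.univ (0 : Site d) (pos w i) := by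
    intro i hi
    induction i with
    | zero => rw [pos_zero]; exact PathIn.refl (Set.mem_univ _)
    | succ i ih =>
      have hi' : i < m + 1 := Nat.lt_of_succ_le hi
      refine ⟨Set.mem_univ _, (ih hi'.le).2.tail ⟨?_, Set.mem_univ _⟩⟩
      rw [pos_succ w hi', openGraph_adj]
      refine ⟨hw ⟨i, hi'⟩, fun heq => ?_⟩
      have := congr_fun heq (w ⟨i, hi'⟩)
      simp [e] at this
  refine DCTQ.armEvent_of_pathIn hω (hpath (m + 1) le_rfl) (Or.inl fun hball => ?_)
  have h1 := norm_le_of_mem_ball m _ hball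
  have h2 : ∑ j, |pos w (m + 1) j| = (m + 1 : ℕ) := by
    rw [← level w le_rfl]
    exact Finset.sum_congr rfl fun j _ => abs_of_nonneg (pos_nonneg w _ j)
  rw [h2] at h1
  push_cast at h1
  linarith

/-! ### Open words in a bit assignment and the two moments -/

/-- The word `w` is open in the bit assignment `a`. -/
def OpenW (a : EIdx d n → Bool) (w : Fin n → Fin d) : Prop := ∀ i : Fin n, a (idx w i) = true

/-- Openness of a word is decidable. -/
instance (a : EIdx d n → Bool) (w : Fin n → Fin d) : Decidable (OpenW a w) := by
  unfold OpenW; infer_instance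

/-- `w` is open iff all the bits of `E(w)` are set. -/
theorem openW_iff (a : EIdx d n → Bool) (w : Fin n → Fin d) : OpenW a w ↔ ∀ y ∈ edgesOf w, a y = true := by
  simp only [OpenW, edgesOf, mem_image, mem_univ, true_and, forall_exists_index, forall_apply_eq_imp_iff]

/-- The configuration of a bit assignment lies in the event iff some word is open. -/
theorem edgeCfg_mem_iff (a : EIdx d n → Bool) : edgeCfg edge a ∈ orientedEvent d n ↔ ∃ w, OpenW a w := by
  simp only [orientedEvent, Set.mem_setOf_eq, OpenW, ← edge_idx, edge_mem_edgeCfg_iff edge_injective]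

/-- **The number of open words.** -/
def N (a : EIdx d n → Bool) : ℝ := ∑ w : Fin n → Fin d, if OpenW a w then 1 else 0

/-- `N ≥ 0`. -/
theorem N_nonneg (a : EIdx d n → Bool) : 0 ≤ N a := Finset.sum_nonneg fun _ _ => by split_ifs <;> norm_num

/-- `N = N · 𝟙[some word is open]`. -/
theorem N_mul_indicator (a : EIdx d n → Bool) : N a * (if ∃ w, OpenW a w then 1 else 0) = N a := by
  split_ifs with h
  · rw [mul_one]
  · push Not at h
    have : N a = 0 := Finset.sum_eq_zero fun w _ => if_neg (h w)
    rw [this, zero_mul]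

/-- The weight of "all bits of `S` set" is `p^{|S|}`. -/
theorem sum_wt_all (p : ℝ) (S : Finset (EIdx d n)) :
    ∑ a : EIdx d n → Bool, wt p a * (if ∀ y ∈ S, a y = true then (1 : ℝ) else 0) = p ^ S.card := by
  rw [← Finset.sum_filter_of_ne (p := fun a => ∀ y ∈ S, a y = true) (fun a _ h => by
    by_contra hh; exact h (by rw [if_neg hh, mul_zero]))]
  have : ∑ a ∈ univ.filter (fun a : EIdx d n → Bool => ∀ y ∈ S, a y = true), wt p a * (if ∀ y ∈ S, a y = true then (1 : ℝ) else 0) =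
      ∑ a ∈ univ.filter (fun a : EIdx d n → Bool => ∀ y ∈ S, a y = (fun _ => true) y), wt p a := by
    refine Finset.sum_congr (by rfl) fun a ha => ?_
    rw [if_pos (mem_filter.1 ha).2, mul_one]
  rw [this, sum_wt_filter_agree, Finset.prod_const]
  rfl

/-- **First moment**: `Σ_a π_p(a) N(a) = (dp)^n`. -/
theorem first_moment (p : ℝ) : ∑ a : EIdx d n → Bool, wt p a * N a = ((d : ℝ) * p) ^ n := by
  unfold N
  simp_rw [Finset.mul_sum]
  rw [Finset.sum_comm]
  have : ∀ w : Fin n → Fin d, ∑ a : EIdx d n → Bool, wt p a * (if OpenW a w then (1 : ℝ) else 0) = p ^ n := by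
    intro w
    simp_rw [openW_iff]
    rw [sum_wt_all, card_edgesOf]
  simp_rw [this]
  rw [Finset.sum_const, card_univ, Fintype.card_fun, Fintype.card_fin, Fintype.card_fin, nsmul_eq_mul]
  push_cast; ring

/-- **Second moment**: `Σ_a π_p(a) N(a)² = p^{2n} · S d (1/p) n 0` (for `p > 0`). -/
theorem second_moment {p : ℝ} (hp : 0 < p) :
    ∑ a : EIdx d n → Bool, wt p a * N a ^ 2 = p ^ (2 * n) * S d (1 / p) n 0 := by
  unfold N S
  have hsq : ∀ a : EIdx d n → Bool, (∑ w : Fin n → Fin d, if OpenW a w then (1 : ℝ) else 0) ^ 2 =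
      ∑ w : Fin n → Fin d, ∑ w' : Fin n → Fin d, if ∀ y ∈ edgesOf w ∪ edgesOf w', a y = true then (1 : ℝ) else 0 := by
    intro a
    rw [sq, Finset.sum_mul_sum]
    refine Finset.sum_congr rfl fun w _ => Finset.sum_congr rfl fun w' _ => ?_
    simp only [openW_iff]
    by_cases h1 : ∀ y ∈ edgesOf w, a y = true
    · by_cases h2 : ∀ y ∈ edgesOf w', a y = true
      · rw [if_pos h1, if_pos h2, if_pos (fun y hy => (mem_union.1 hy).elim (h1 y) (h2 y)), one_mul]
      · rw [if_neg h2, mul_zero, if_neg (fun h => h2 fun y hy => h y (mem_union_right _ hy))]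
    · rw [if_neg h1, zero_mul, if_neg (fun h => h1 fun y hy => h y (mem_union_left _ hy))]
  simp_rw [hsq, Finset.mul_sum]
  rw [Finset.sum_comm]
  refine Finset.sum_congr rfl fun w _ => ?_
  rw [Finset.sum_comm]
  refine Finset.sum_congr rfl fun w' _ => ?_
  rw [sum_wt_all, Finset.card_union, card_edgesOf, card_edgesOf, card_inter]
  have hK : K 0 w w' ≤ n := by
    rw [K]; exact (Finset.card_filter_le _ _).trans (by rw [card_univ, Fintype.card_fin])
  rw [one_div, inv_pow, ← div_eq_mul_inv, eq_div_iff (pow_ne_zero _ hp.ne'), ← pow_add]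
  congr 1; omega

/-- **Cauchy–Schwarz**: `(Σ π N)² ≤ (Σ π N²) · (Σ π 𝟙[N ≥ 1])`. -/
theorem moment_ineq {p : ℝ} (hp0 : 0 ≤ p) (hp1 : p ≤ 1) :
    (∑ a : EIdx d n → Bool, wt p a * N a) ^ 2 ≤
      (∑ a : EIdx d n → Bool, wt p a * N a ^ 2) *
        ∑ a : EIdx d n → Bool, wt p a * (if ∃ w, OpenW a w then (1 : ℝ) else 0) := by
  have hw : ∀ a : EIdx d n → Bool, 0 ≤ wt p a := wt_nonneg hp0 hp1
  have key := Finset.sum_mul_sq_le_sq_mul_sq (univ : Finset (EIdx d n → Bool))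
    (fun a => Real.sqrt (wt p a) * N a) (fun a => Real.sqrt (wt p a) * (if ∃ w, OpenW a w then (1 : ℝ) else 0))
  have e1 : ∀ a : EIdx d n → Bool, Real.sqrt (wt p a) * N a * (Real.sqrt (wt p a) * (if ∃ w, OpenW a w then (1 : ℝ) else 0)) =
      wt p a * N a := by
    intro a
    calc Real.sqrt (wt p a) * N a * (Real.sqrt (wt p a) * (if ∃ w, OpenW a w then (1 : ℝ) else 0))
        = (Real.sqrt (wt p a) * Real.sqrt (wt p a)) * (N a * (if ∃ w, OpenW a w then (1 : ℝ) else 0)) := by ring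
      _ = wt p a * N a := by rw [Real.mul_self_sqrt (hw a), N_mul_indicator]
  have e2 : ∀ a : EIdx d n → Bool, (Real.sqrt (wt p a) * N a) ^ 2 = wt p a * N a ^ 2 := by
    intro a; rw [mul_pow, Real.sq_sqrt (hw a)]
  have e3 : ∀ a : EIdx d n → Bool, (Real.sqrt (wt p a) * (if ∃ w, OpenW a w then (1 : ℝ) else 0)) ^ 2 =
      wt p a * (if ∃ w, OpenW a w then (1 : ℝ) else 0) := by
    intro a; rw [mul_pow, Real.sq_sqrt (hw a)]; split_ifs <;> simp
  simp_rw [e1, e2, e3] at key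
  exact key

/-- **The second-moment bound**: `P_p(some oriented path of length n is open) ≥ d^{2n} / S d (1/p) n 0`. -/
theorem le_real_orientedEvent [NeZero d] (p : unitInterval) (hp : 0 < (p : ℝ)) :
    (d : ℝ) ^ (2 * n) / S d (1 / p) n 0 ≤ (bondPercolation (zdGraph d) p).real (orientedEvent d n) := by
  have hreal : (bondPercolation (zdGraph d) p).real (orientedEvent d n) =
      ∑ a : EIdx d n → Bool, wt (p : ℝ) a * (if ∃ w, OpenW a w then (1 : ℝ) else 0) := by
    rw [real_eq_sum_wt_of_injective (zdGraph d) p edge edge_injective edge_mem_edgeSet determinedBy_orientedEvent]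
    refine Finset.sum_congr rfl fun a _ => ?_
    congr 1
    by_cases h : ∃ w, OpenW a w
    · rw [if_pos h, Set.indicator_of_mem ((edgeCfg_mem_iff a).2 h)]; rfl
    · rw [if_neg h, Set.indicator_of_notMem (fun h' => h ((edgeCfg_mem_iff a).1 h'))]
  rw [hreal]
  have h1 := first_moment (d := d) (n := n) (p : ℝ)
  have h2 := second_moment (d := d) (n := n) hp
  have hcs := moment_ineq (d := d) (n := n) p.2.1 p.2.2
  rw [h1, h2] at hcs
  have hS : 0 < S d (1 / p) n 0 := by
    unfold S
    refine Finset.sum_pos (fun w _ => Finset.sum_pos (fun w' _ => by positivity) univ_nonempty) univ_nonempty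
  have hpn : (0 : ℝ) < (p : ℝ) ^ (2 * n) := pow_pos hp _
  rw [div_le_iff₀ hS]
  have e : ((d : ℝ) * p) ^ n = 0 ∨ True := Or.inr trivial
  -- `(dp)^{2n} ≤ p^{2n} S · P`
  have : ((d : ℝ) * p) ^ n * ((d : ℝ) * p) ^ n ≤ (p : ℝ) ^ (2 * n) * S d (1 / p) n 0 *
      ∑ a : EIdx d n → Bool, wt (p : ℝ) a * (if ∃ w, OpenW a w then (1 : ℝ) else 0) := by rw [← sq]; exact hcs
  have e2 : ((d : ℝ) * p) ^ n * ((d : ℝ) * p) ^ n = (p : ℝ) ^ (2 * n) * (d : ℝ) ^ (2 * n) := by ring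
  rw [e2, mul_assoc] at this
  have := le_of_mul_le_mul_left this hpn
  linarith

/-- **The bridge**: `d^{2(m+1)} / S d (1/p) (m+1) 0 ≤ P_p(0 ⟷ ∂B(0, m))` on `ℤ^d`. -/
theorem le_real_armEvent [NeZero d] (p : unitInterval) (hp : 0 < (p : ℝ)) (m : ℕ) :
    (d : ℝ) ^ (2 * (m + 1)) / S d (1 / p) (m + 1) 0 ≤
      (bondPercolation (zdGraph d) p).real (DCTQ.armEvent (zdGraph d) (0 : Site d) m) :=
  (le_real_orientedEvent p hp).trans
    (DCT16.real_mono_of_forall_subset_edgeSet (zdGraph d) p fun _ hω hE => armEvent_of_orientedEvent hω hE)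

end Summit.CriticalPhenomena.PercolationContinuityZ3.Theorems.Pcint.OSM

end
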